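/-
Copyright: cell pub-balaban-gaps (YM BLITZ Y1, track G1), seat g1-p2 GEN 5 (unit `pub-balaban-gaps-g1-p2`).  Row (D4) NODE O,
OBJECT ∕ MECHANISM level: [B9] THEOREM 3.10 AT ONE SCALE IN BLOCK CURRENCY WITH PRINT'S WALK BOOKKEEPING IN FULL — (i) DECAYING
block letters for the one-step families (`D4WalkBlockLocalDecay`: amplitude `λ`, the operators' OWN rate, no `e^{2ρr}`), run
UNTAGGED (no σ-region at the step level); (ii) ROUTE ONCE PER WALK (`D4WalkBlockReroute`: walks one of whose domains meets the
σ-region `X` pass within `2r` of `X` — slack `2r` once, [B9] (3.154)); (iii) DECORATE ONCE PER PARAMETER (`D4WalkBlockDecorate` under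
`D4WalkBlockDecorateChains`' tube letter: window shift `κ₁P∕r₀`, [II] (1.11) «δ₁M ≥ κ₁»).  The margin `q` carries NEITHER `e^{κ₁m_J}`
NOR `e^{2ρ₀r}`: at fixed geometry it is `O(λ_R)` at the operators' own decay rate — print's regime in print's three-scale geometry
([II] p. 3: walk cubes of the localization size `M₁`, parameters = `M`-cubes).
HONEST FRAMING: mechanism over hypothesis letters (decaying block-local seed ∕ step data, packing, parameter attachment); nothing of
Bałaban's constructed; (D4) NOT discharged (instance 0∕1); NOT BetaPertH, NOT continuum, NOT Clay.
-/
import Summits.QuantumFields.BalabanUV.Gaps.D4WalkBlockOneScaleDecorated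
import Summits.QuantumFields.BalabanUV.Gaps.D4WalkBlockReroute
import Summits.QuantumFields.BalabanUV.Gaps.D4WalkBlockLocalDecay

/-!
# `Gaps.D4WalkBlockOneScalePrint` — Thm 3.10 at one scale: decaying letters, route once per walk, decorate once per parameter
(cell pub-balaban-gaps, seat g1-p2 gen 5)

HONEST DEPENDENCY (cell pub-balaban, verbatim): continuum YM on T⁴ ⇐ BetaPertH ∧ nine spine estimates (0/9 proved);
BetaPertH ⇐ (D1) ∧ (D4) ∧ CAP+tail.

* §1 `split_points`: every domain visited by the chain `(b₀, l)` contains a point `v` with `d₁(y,v) + d₁(v,y′) ≤ Dch b₀ l (y,y′)`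
  (the chain distance splits at a via point of every step); `near_of_meets`: if a visited domain (diameter `≤ r`) meets `X` then
  `∃ z ∈ X, d₁(y,z) + d₁(z,y′) ≤ Dch b₀ l (y,y′) + 2r` — the `hnear` letter of `blockWalkExpansion_reroute` for the parametrix chains.
* §2 **`blockWalkExpansion_oneScale_print`**: seed ∕ step families with DECAYING block letters `(R, λ_S ∕ λ_R, ρ₀, r, n_D)` and NO
  σ-tags (`J = ∅`; the σ-region enters only through `meets b := (dom b ∩ X).Nonempty` and the true parameter sets `J′ b`, non-empty
  only for meeting domains), cube row sum `(μ, c_μ)`, rates `0 ≤ μ`, `3μ ≤ ε₀`, `2μ ≤ κ₀`, `κ₀ + μ ≤ ρ₀ − ε₀`, margin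
  `q = c_μ(c_μ·1·(1·K̄_R)c_μ)c_μ < 1` with `K̄_R = λ_R·e^{μr}·n_D·c_μ` — NO `e^{κ₁m_J}`, NO `e^{2ρ₀r}` —, packing `P` at radius
  `R_b ≥ r₀ + r`, shift `κ₁P∕r₀ ≤ ε₀ − 3μ` ⟹ the decorated, re-routed glued family is a `BlockWalkExpansion` at the physical consts:
  window `ε₀ − 3μ − κ₁P∕r₀`, rate `ρ₀ − 3μ − κ₁P∕r₀`, torus rate `κ₀ − 2μ`, constant `e^{κ₁P}·e^{(ε₀−3μ)2r}·K̄_glued`, σ-region `X`,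
  σ-carrying set `{dec ≠ ∅}`; its kernel at `σ ≡ 1` is `S(1 − R)⁻¹`.
* §2′ `blockWalkExpansion_oneScale_print_rate` (GEN 6 append): the same with the walk rate `ρ₀ − 3μ − κ₁P∕r₀` EXPOSED in the type
  (no `∃ ρ′`), for consumers that multiply ∕ perturb the expansion again (`Gaps/D4WalkBlockTail`).
WHAT IT IS NOT: nothing of Bałaban's; the (v)⁺ repackaging is routine; (D4) instance 0∕1; words UNCHANGED.
-/

noncomputable section

namespace Summit.QuantumFields.BalabanUV.Gaps.D4WalkBlockOneScalePrint

open Metric Set Finset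
open Literature.MathematicalPhysics.QuantumFieldTheory.Balaban1983to89
open Literature.MathematicalPhysics.QuantumFieldTheory.Balaban1983to89.B9SectDWalk (Through MajSumLe DomBy infConv chainDist infConv_le exists_infConv_eq)
open Literature.MathematicalPhysics.QuantumFieldTheory.Balaban1983to89.B9Thm34Ext (toB6)
open Literature.MathematicalPhysics.QuantumFieldTheory.Balaban1983to89.B9Thm37GlueTorus (torusGeom tdist1 tdist1_nonneg tdist1_triangle tdist1_comm)
open Literature.MathematicalPhysics.QuantumFieldTheory.Balaban1983to89.TreeLengthTorus (TPt)
open Literature.MathematicalPhysics.QuantumFieldTheory.Balaban1983to89.B5TorusCover (UT)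
open Literature.MathematicalPhysics.QuantumFieldTheory.Balaban1983to89.B11SectG (RowSum)
open Literature.MathematicalPhysics.QuantumFieldTheory.Balaban1983to89.B13DomainKernelWalks (DomainTerms)
open Summit.QuantumFields.BalabanUV.Gaps.D4WalkBlock (blockNorm BlockWalkExpansion)
open Summit.QuantumFields.BalabanUV.Gaps.D4WalkProduct (domBy_infConv_torus)
open Summit.QuantumFields.BalabanUV.Gaps.D4WalkNeumann (domBy_chain)
open Summit.QuantumFields.BalabanUV.Gaps.D4WalkBlockProduct (blockWalkExpansion_mul)
open Summit.QuantumFields.BalabanUV.Gaps.D4WalkBlockNeumann (blockWalkExpansion_inv_pencil)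
open Summit.QuantumFields.BalabanUV.Gaps.D4WalkBlockGlue (blockWalkExpansion_one)
open Summit.QuantumFields.BalabanUV.Gaps.D4WalkBlockLocalDecay (IsDomainLocalBD blockWalkExpansion_domainLocalD)
open Summit.QuantumFields.BalabanUV.Gaps.D4WalkBlockDecorate (decTerm decKernel blockWalkExpansion_decorate kernel_decorate_one)
open Summit.QuantumFields.BalabanUV.Gaps.D4WalkBlockDecorateChains (Dch card_params_le dist_le_infConv_tdist1)
open Summit.QuantumFields.BalabanUV.Gaps.D4WalkBlockOneScaleDecorated (decG mem_decG decG_nonempty)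
open Summit.QuantumFields.BalabanUV.Gaps.D4WalkBlockReroute (blockWalkExpansion_reroute domBy_reroute)
open Summit.QuantumFields.BalabanUV.T4Continuum.Spine.NE5.TwoRunPencilDomains (withOp)

variable {ν : ℕ} {K : Fin ν → ℕ} [∀ i, NeZero (K i)]
variable {d N' : ℕ} {n : Type} [Fintype n] [DecidableEq n]
variable {E : Type*} [NormedAddCommGroup E] [NormedSpace ℂ E]

/-! ## §1. The chain distance splits at a point of every visited domain -/

section Split

variable {L : DomainTerms d N' ν K n n E} {X₀ : Finset (UT K)}

omit [Fintype n] [DecidableEq n] in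
/-- The chain distance dominates the cube distance. [cite: Balaban1984PropagatorsII, (2.54) p.233] -/
theorem tdist1_le_Dch (b₀ : L.B) (l : List (Unit × L.B)) (y y' : UT K) : tdist1 K y y' ≤ Dch L X₀ b₀ l y y' :=
  domBy_infConv_torus (L.domBy_dist X₀ b₀)
    (domBy_chain (DC := fun _ : Unit => tdist1 K) (fun _ _ _ => le_rfl) (fun b => L.domBy_dist X₀ b) (l, ())) y y'

omit [Fintype n] [DecidableEq n] in
/-- **SPLIT POINTS**: every domain visited by the chain `(b₀, l)` contains a point `v` with `d₁(y,v) + d₁(v,y′) ≤ Dch b₀ l (y,y′)`.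
[cite: Balaban1985BackgroundPropagators, (3.93) p.410] -/
theorem split_points (hdom : ∀ b, (L.dom b).Nonempty) :
    ∀ (l : List (Unit × L.B)) (b₀ : L.B) (y y' : UT K),
      (∃ v ∈ L.dom b₀, tdist1 K y v + tdist1 K v y' ≤ Dch L X₀ b₀ l y y') ∧
        ∀ i ∈ l, ∃ v ∈ L.dom i.2, tdist1 K y v + tdist1 K v y' ≤ Dch L X₀ b₀ l y y'
  | [], b₀, y, y' => by
      obtain ⟨z, hz⟩ := exists_infConv_eq (g := toB6 (torusGeom K 0 0 0) 0 True) (L.dist X₀ b₀) (tdist1 K) y y'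
      obtain ⟨v, hv, e⟩ := L.exists_dist_eq X₀ b₀ (L.via_nonempty X₀ (hdom b₀)) y z
      refine ⟨⟨v, L.via_subset X₀ b₀ hv, ?_⟩, fun i hi => by simp at hi⟩
      rw [Dch, chainDist, hz, e]
      linarith [tdist1_triangle (N := K) v z y']
  | i :: l, b₀, y, y' => by
      obtain ⟨z, hz⟩ := exists_infConv_eq (g := toB6 (torusGeom K 0 0 0) 0 True) (L.dist X₀ b₀)
        (chainDist (g := toB6 (torusGeom K 0 0 0) 0 True)
          (fun i : Unit × L.B => infConv (g := toB6 (torusGeom K 0 0 0) 0 True) (tdist1 K) (L.dist X₀ i.2)) (tdist1 K) (i :: l))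
        y y'
      obtain ⟨z₁, hz₁⟩ := exists_infConv_eq (g := toB6 (torusGeom K 0 0 0) 0 True)
        (infConv (g := toB6 (torusGeom K 0 0 0) 0 True) (tdist1 K) (L.dist X₀ i.2))
        (chainDist (g := toB6 (torusGeom K 0 0 0) 0 True)
          (fun i : Unit × L.B => infConv (g := toB6 (torusGeom K 0 0 0) 0 True) (tdist1 K) (L.dist X₀ i.2)) (tdist1 K) l) z y'
      have htail : Dch L X₀ i.2 l z y' ≤
          infConv (g := toB6 (torusGeom K 0 0 0) 0 True) (tdist1 K) (L.dist X₀ i.2) z z₁ +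
            chainDist (g := toB6 (torusGeom K 0 0 0) 0 True)
              (fun i : Unit × L.B => infConv (g := toB6 (torusGeom K 0 0 0) 0 True) (tdist1 K) (L.dist X₀ i.2)) (tdist1 K) l
              z₁ y' :=
        (infConv_le (g := toB6 (torusGeom K 0 0 0) 0 True) _ _ z y' z₁).trans
          (add_le_add (dist_le_infConv_tdist1 hdom i.2 z z₁) le_rfl)
      -- Dch b₀ (i :: l) (y,y′) = D_{b₀}(y,z) + D_i(z,z₁) + chainDist l (z₁,y′) ≥ D_{b₀}(y,z) + Dch i.2 l (z,y′)
      have e1 : Dch L X₀ b₀ (i :: l) y y' = L.dist X₀ b₀ y z +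
          (infConv (g := toB6 (torusGeom K 0 0 0) 0 True) (tdist1 K) (L.dist X₀ i.2) z z₁ +
            chainDist (g := toB6 (torusGeom K 0 0 0) 0 True)
              (fun i : Unit × L.B => infConv (g := toB6 (torusGeom K 0 0 0) 0 True) (tdist1 K) (L.dist X₀ i.2)) (tdist1 K) l
              z₁ y') := by
        unfold Dch; rw [hz, chainDist, hz₁]
      have hmain : L.dist X₀ b₀ y z + Dch L X₀ i.2 l z y' ≤ Dch L X₀ b₀ (i :: l) y y' := by rw [e1]; linarith
      have hDz : tdist1 K z y' ≤ Dch L X₀ i.2 l z y' := tdist1_le_Dch i.2 l z y'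
      have hLyz : tdist1 K y z ≤ L.dist X₀ b₀ y z := L.tdist1_le_dist X₀ b₀ y z
      obtain ⟨⟨w₀, hw₀, hw₀d⟩, hcov⟩ := split_points hdom l i.2 z y'
      obtain ⟨v₀, hv₀, e₀⟩ := L.exists_dist_eq X₀ b₀ (L.via_nonempty X₀ (hdom b₀)) y z
      refine ⟨⟨v₀, L.via_subset X₀ b₀ hv₀, ?_⟩, fun i' hi' => ?_⟩
      · have h1 := tdist1_triangle (N := K) v₀ z y'
        rw [e₀] at hmain; linarith
      · rcases List.mem_cons.1 hi' with rfl | hi''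
        · refine ⟨w₀, hw₀, ?_⟩
          have h1 := tdist1_triangle (N := K) y z w₀
          linarith
        · obtain ⟨v, hv, hvd⟩ := hcov i' hi''
          refine ⟨v, hv, ?_⟩
          have h1 := tdist1_triangle (N := K) y z v
          linarith

omit [Fintype n] [DecidableEq n] in
/-- **THE `hnear` LETTER FOR THE CHAINS**: if a visited domain (diameter `≤ r`) meets `X`, the chain distance passes within `2r` of `X`.
[cite: Balaban1985BackgroundPropagators, (3.93) p.410, (3.154) p.427] -/
theorem near_of_meets (hdom : ∀ b, (L.dom b).Nonempty) {r : ℝ} (hdiam : ∀ b, ∀ z ∈ L.dom b, ∀ z' ∈ L.dom b, tdist1 K z z' ≤ r)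
    (X : Finset (UT K)) (b₀ : L.B) (l : List (Unit × L.B))
    (hmeet : (L.dom b₀ ∩ X).Nonempty ∨ ∃ i ∈ l, (L.dom i.2 ∩ X).Nonempty) (y y' : UT K) :
    ∃ z ∈ X, tdist1 K y z + tdist1 K z y' ≤ Dch L X₀ b₀ l y y' + 2 * r := by
  obtain ⟨h0, hl⟩ := split_points (X₀ := X₀) hdom l b₀ y y'
  have key : ∀ b, (L.dom b ∩ X).Nonempty → (∃ v ∈ L.dom b, tdist1 K y v + tdist1 K v y' ≤ Dch L X₀ b₀ l y y') →
      ∃ z ∈ X, tdist1 K y z + tdist1 K z y' ≤ Dch L X₀ b₀ l y y' + 2 * r := by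
    rintro b ⟨x, hx⟩ ⟨v, hv, hvd⟩
    rw [Finset.mem_inter] at hx
    refine ⟨x, hx.2, ?_⟩
    have h1 := tdist1_triangle (N := K) y v x
    have h2 := tdist1_triangle (N := K) x v y'
    have h3 := hdiam b v hv x hx.1
    have h4 : tdist1 K x v ≤ r := by rw [tdist1_comm]; exact h3
    linarith
  rcases hmeet with hm0 | ⟨i, hi, hmi⟩
  · exact key b₀ hm0 h0
  · exact key i.2 hmi (hl i hi)

end Split

/-! ## §2. THE END: decaying letters, route once per walk, decorate once per parameter -/

section End

variable {c₀ c : B13.Consts} {cubn : n → UT K} {X : Finset (UT K)}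
variable {L : DomainTerms d N' ν K n n E} {opS opR : L.B → E → Matrix n n ℂ}
variable {R lamS lamR r : ℝ} {nD : ℕ} {ρ₀ ε₀ κ₀ μ cμ : ℝ}

/-- **THEOREM 3.10 AT ONE SCALE, PRINT'S BOOKKEEPING IN FULL.**  See the module docstring (§2). [cite: Balaban1988RG2Cluster, p.3, (1.11) p.5, p.13, p.15, (2.16) p.16; Balaban1985BackgroundPropagators, Thms 3.1–3.3 (3.42) p.399, Thm 3.7 (3.87)–(3.90) p.409, Cor 3.8 p.410, Thm 3.10 (3.107)–(3.108) p.416, (3.154) p.427; Balaban1984PropagatorsII, (2.61) p.234] -/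
theorem blockWalkExpansion_oneScale_print
    (hS : IsDomainLocalBD (withOp L opS) c₀ cubn cubn ∅ R lamS ρ₀ r 0 nD)
    (hR : IsDomainLocalBD (withOp L opR) c₀ cubn cubn ∅ R lamR ρ₀ r 0 nD)
    (hκ₁₀ : 0 ≤ c₀.κ₁) (hlamS : 0 ≤ lamS) (hlamR : 0 ≤ lamR) (hr : 0 ≤ r)
    (hμ : 0 ≤ μ) (hμε : 3 * μ ≤ ε₀) (hμκ : 2 * μ ≤ κ₀) (hwin : κ₀ + μ ≤ ρ₀ - ε₀) (hcμ : 0 ≤ cμ)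
    (hrow : RowSum (toB6 (torusGeom K 0 0 0) 0 True) μ cμ)
    (hq : cμ * (cμ * 1 * (1 * ((lamR * Real.exp (c₀.κ₁ * (0 : ℕ))) * Real.exp (μ * r) * (nD * cμ))) * cμ) * cμ < 1)
    -- decoration data
    (cellOf : UT K → TPt d N') (J' : L.B → Finset (TPt d N')) (hJ' : ∀ b, J' b ⊆ (L.dom b).image cellOf)
    (hJ'X : ∀ b, (J' b).Nonempty → (L.dom b ∩ X).Nonempty) {P : ℕ} {r₀ Rb : ℝ} (hr₀ : 0 < r₀) (hRD : r₀ + r ≤ Rb)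
    (hpack : ∀ a : UT K, ∃ S : Finset (TPt d N'), S.card ≤ P ∧ ∀ z, tdist1 K a z ≤ Rb → cellOf z ∈ S)
    (hκ₁ : 0 ≤ c.κ₁) (hshift : c.κ₁ * (P / r₀) ≤ ε₀ - 3 * μ) :
    ∃ (W : Type) (T : W → (TPt d N' → ℂ) → E → Matrix n n ℂ) (A : W → ℝ) (D : W → UT K → UT K → ℝ) (ρ' : ℝ)
      (dec : W → Finset (TPt d N')),
      BlockWalkExpansion c cubn cubn (decKernel T dec) X R (ε₀ - 3 * μ - c.κ₁ * (P / r₀)) (κ₀ - 2 * μ)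
        (Real.exp (c.κ₁ * P) * (Real.exp ((ε₀ - 3 * μ) * (2 * r)) *
          (cμ * ((lamS * Real.exp (c₀.κ₁ * (0 : ℕ))) * Real.exp (μ * r) * (nD * cμ)) *
            (1 * (1 - cμ * (cμ * 1 * (1 * ((lamR * Real.exp (c₀.κ₁ * (0 : ℕ))) * Real.exp (μ * r) * (nD * cμ))) * cμ) * cμ)⁻¹) *
              cμ)))
        (decTerm T dec) {w | (dec w).Nonempty} A D ρ' ∧
      (∀ u ∈ ball (0 : E) R, decKernel T dec (fun _ => 1) u =
        (withOp L opS).kernel (fun _ => 1) u * ((1 : Matrix n n ℂ) + (-1 : ℂ) • (withOp L opR).kernel (fun _ => 1) u)⁻¹) ∧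
      ∀ ω, DomBy (toB6 (torusGeom K 0 0 0) 0 True) (D ω) := by
  have hκ₀ : 0 ≤ κ₀ := by linarith
  have hρ₀ : 0 ≤ ρ₀ := by linarith
  -- (i) the two UNTAGGED domain-local BLOCK expansions with DECAYING letters at their own rate ρ₀
  have hSw := blockWalkExpansion_domainLocalD hS hκ₁₀ hlamS hρ₀ hκ₀ hμ hwin hrow
  have hRw := blockWalkExpansion_domainLocalD hR hκ₁₀ hlamR hρ₀ hκ₀ hμ hwin hrow
  have hSdom : ∀ b, DomBy (toB6 (torusGeom K 0 0 0) 0 True) ((withOp L opS).dist ∅ b) := fun b => (withOp L opS).domBy_dist ∅ b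
  have hRdom : ∀ b, DomBy (toB6 (torusGeom K 0 0 0) 0 True) ((withOp L opR).dist ∅ b) := fun b => (withOp L opR).domBy_dist ∅ b
  -- GEN 4's glue with its witnesses kept
  have hone := blockWalkExpansion_one (d := d) (N' := N') (E := E) c₀ cubn (∅ : Finset (UT K)) R
    ((ρ₀ - μ) + μ - ((ρ₀ - 2 * μ) - (ε₀ - 2 * μ))) ((ρ₀ - 2 * μ) - (ε₀ - 2 * μ))
  have hinv := blockWalkExpansion_inv_pencil (A := fun (_ : TPt d N' → ℂ) (_ : E) => (1 : Matrix n n ℂ))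
    (t := (-1 : ℂ)) (τ := 1) (ρ := ρ₀ - 2 * μ) (ε := ε₀ - 2 * μ) (ρs := ρ₀ - μ) (κs := κ₀ - μ) (κ := κ₀ - 2 * μ)
    hone hRw (fun _ a b => le_rfl) hRdom (fun σ₀ _ u _ => Matrix.one_mul _) hrow hrow hμ hμ hcμ hcμ
    (by linarith) (by linarith) (by linarith) (by linarith) (by linarith) (by linarith) (by linarith) zero_le_one (by positivity)
    (by linarith) (by linarith) (by linarith) (by linarith) (by linarith) (by linarith) zero_le_one (by simp) hq
  have hq1 : 0 < 1 - cμ * (cμ * 1 * (1 * ((lamR * Real.exp (c₀.κ₁ * (0 : ℕ))) * Real.exp (μ * r) * (nD * cμ))) * cμ) * cμ := by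
    linarith
  have hCdom : ∀ ω : List (Unit × L.B) × Unit, DomBy (toB6 (torusGeom K 0 0 0) 0 True)
      (chainDist (g := toB6 (torusGeom K 0 0 0) 0 True)
        (fun i : Unit × L.B => infConv (g := toB6 (torusGeom K 0 0 0) 0 True) (tdist1 K)
          ((withOp L opR).dist ∅ i.2)) (tdist1 K) ω.1) :=
    fun ω => domBy_chain (DC := fun _ : Unit => tdist1 K) (fun _ a b => le_rfl) hRdom ω
  have hmul := blockWalkExpansion_mul (ρ := ρ₀ - 3 * μ) (ε := ε₀ - 3 * μ) (κ := κ₀ - 2 * μ) hSw hinv hSdom hCdom hrow hrow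
    (by linarith) (by linarith) hμ (by linarith) (by linarith) (by linarith) (by linarith) (by positivity) (by positivity)
    (by linarith) le_rfl (by linarith) hcμ
  -- (ii) route ONCE per walk: walks with a domain meeting X pass within 2r of X
  have hdom : ∀ b, (L.dom b).Nonempty := fun b => ⟨L.anchor b, hS.hanchor b⟩
  have hmulD : ∀ ω : L.B × (List (Unit × L.B) × Unit), DomBy (toB6 (torusGeom K 0 0 0) 0 True)
      (infConv (g := toB6 (torusGeom K 0 0 0) 0 True) ((withOp L opS).dist ∅ ω.1)
        (chainDist (g := toB6 (torusGeom K 0 0 0) 0 True)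
          (fun i : Unit × L.B => infConv (g := toB6 (torusGeom K 0 0 0) 0 True) (tdist1 K) ((withOp L opR).dist ∅ i.2))
          (tdist1 K) ω.2.1)) := fun ω => domBy_infConv_torus (hSdom ω.1) (hCdom ω.2)
  -- untagged families: NO term is σ-carrying (J = ∅ everywhere)
  have hJS : ∀ b, b ∉ (withOp L opS).sigmaCarrying := fun b hb => by
    have h1 : 0 < ((withOp L opS).J b).card := Finset.card_pos.2 hb
    have h2 := hS.hJ b
    omega
  have hJR : ∀ b, b ∉ (withOp L opR).sigmaCarrying := fun b hb => by
    have h1 : 0 < ((withOp L opR).J b).card := Finset.card_pos.2 hb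
    have h2 := hR.hJ b
    omega
  have hre := blockWalkExpansion_reroute hmul {ω | (L.dom ω.1 ∩ X).Nonempty ∨ ∃ i ∈ ω.2.1, (L.dom i.2 ∩ X).Nonempty} X
    (s := 2 * r) (by positivity)
    (fun ω _ σ hσ => hmul.indep ω (by
      rintro (h | h | ⟨i, _, h | h⟩)
      · exact hJS _ h
      · exact h
      · exact h
      · exact hJR _ h) σ hσ)
    (fun ω hω y y' => near_of_meets (X₀ := ∅) hdom hS.hdiam X ω.1 ω.2.1 hω y y')
  -- (iii) decorate ONCE per parameter under the tube letter
  refine ⟨_, _, _, _, _, decG J', blockWalkExpansion_decorate hre hκ₁₀ hκ₁ (decG J') (fun ω hω => ?_) (P₀ := P)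
    (P₁ := P / r₀) (fun ω u _ y y' _ => ?_) hshift, fun u hu => ?_, fun ω => domBy_reroute hmulD (by positivity) ω⟩
  · rcases decG_nonempty J' ω hω with h0 | ⟨i, hi, hJi⟩
    · exact Or.inl (hJ'X ω.1 h0)
    · exact Or.inr ⟨i, hi, hJ'X i.2 hJi⟩
  · have h := card_params_le (L := L) (X := ∅) hdom hr₀ hRD hS.hdiam cellOf hpack J' hJ' ω.1 ω.2.1 y y' (decG J' ω)
      (fun δ hδ => mem_decG J' ω.1 ω.2.1 ω.2.2 hδ)
    have e : (P : ℝ) * (1 + Dch L ∅ ω.1 ω.2.1 y y' / r₀) = P + P / r₀ * Dch L ∅ ω.1 ω.2.1 y y' := by ring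
    rw [e] at h
    have hP : 0 ≤ (P : ℝ) / r₀ := div_nonneg (Nat.cast_nonneg P) hr₀.le
    calc ((decG J' ω).card : ℝ) ≤ P + P / r₀ * Dch L ∅ ω.1 ω.2.1 y y' := h
      _ ≤ P + P / r₀ * (Dch L ∅ ω.1 ω.2.1 y y' + 2 * r) := by nlinarith
  · exact kernel_decorate_one hre hκ₁₀ (decG J') u hu

/-- **THEOREM 3.10 AT ONE SCALE, PRINT'S BOOKKEEPING IN FULL — THE WALK RATE EXPOSED** (seat g1-p2 GEN 6 append): the same
composition as `blockWalkExpansion_oneScale_print` with the walk rate PINNED at `ρ₀ − 3μ − κ₁P∕r₀` (the module docstring's value,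
hidden under `∃ ρ′` above) — needed by every consumer that multiplies or perturbs the expansion again, e.g. the resolvent ∕ tail step
`Gaps/D4WalkBlockTail.blockWalkExpansion_tail` ([B9] (3.130)).  See the module docstring (§2). [cite: Balaban1988RG2Cluster, p.3, (1.11) p.5, p.13, p.15, (2.16) p.16; Balaban1985BackgroundPropagators, Thms 3.1–3.3 (3.42) p.399, Thm 3.7 (3.87)–(3.90) p.409, Cor 3.8 p.410, Thm 3.10 (3.107)–(3.108) p.416, (3.154) p.427; Balaban1984PropagatorsII, (2.61) p.234] -/
theorem blockWalkExpansion_oneScale_print_rate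
    (hS : IsDomainLocalBD (withOp L opS) c₀ cubn cubn ∅ R lamS ρ₀ r 0 nD)
    (hR : IsDomainLocalBD (withOp L opR) c₀ cubn cubn ∅ R lamR ρ₀ r 0 nD)
    (hκ₁₀ : 0 ≤ c₀.κ₁) (hlamS : 0 ≤ lamS) (hlamR : 0 ≤ lamR) (hr : 0 ≤ r)
    (hμ : 0 ≤ μ) (hμε : 3 * μ ≤ ε₀) (hμκ : 2 * μ ≤ κ₀) (hwin : κ₀ + μ ≤ ρ₀ - ε₀) (hcμ : 0 ≤ cμ)
    (hrow : RowSum (toB6 (torusGeom K 0 0 0) 0 True) μ cμ)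
    (hq : cμ * (cμ * 1 * (1 * ((lamR * Real.exp (c₀.κ₁ * (0 : ℕ))) * Real.exp (μ * r) * (nD * cμ))) * cμ) * cμ < 1)
    -- decoration data
    (cellOf : UT K → TPt d N') (J' : L.B → Finset (TPt d N')) (hJ' : ∀ b, J' b ⊆ (L.dom b).image cellOf)
    (hJ'X : ∀ b, (J' b).Nonempty → (L.dom b ∩ X).Nonempty) {P : ℕ} {r₀ Rb : ℝ} (hr₀ : 0 < r₀) (hRD : r₀ + r ≤ Rb)
    (hpack : ∀ a : UT K, ∃ S : Finset (TPt d N'), S.card ≤ P ∧ ∀ z, tdist1 K a z ≤ Rb → cellOf z ∈ S)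
    (hκ₁ : 0 ≤ c.κ₁) (hshift : c.κ₁ * (P / r₀) ≤ ε₀ - 3 * μ) :
    ∃ (W : Type) (T : W → (TPt d N' → ℂ) → E → Matrix n n ℂ) (A : W → ℝ) (D : W → UT K → UT K → ℝ)
      (dec : W → Finset (TPt d N')),
      BlockWalkExpansion c cubn cubn (decKernel T dec) X R (ε₀ - 3 * μ - c.κ₁ * (P / r₀)) (κ₀ - 2 * μ)
        (Real.exp (c.κ₁ * P) * (Real.exp ((ε₀ - 3 * μ) * (2 * r)) *
          (cμ * ((lamS * Real.exp (c₀.κ₁ * (0 : ℕ))) * Real.exp (μ * r) * (nD * cμ)) *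
            (1 * (1 - cμ * (cμ * 1 * (1 * ((lamR * Real.exp (c₀.κ₁ * (0 : ℕ))) * Real.exp (μ * r) * (nD * cμ))) * cμ) * cμ)⁻¹) *
              cμ)))
        (decTerm T dec) {w | (dec w).Nonempty} A D (ρ₀ - 3 * μ - c.κ₁ * (P / r₀)) ∧
      (∀ u ∈ ball (0 : E) R, decKernel T dec (fun _ => 1) u =
        (withOp L opS).kernel (fun _ => 1) u * ((1 : Matrix n n ℂ) + (-1 : ℂ) • (withOp L opR).kernel (fun _ => 1) u)⁻¹) ∧
      ∀ ω, DomBy (toB6 (torusGeom K 0 0 0) 0 True) (D ω) := by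
  have hκ₀ : 0 ≤ κ₀ := by linarith
  have hρ₀ : 0 ≤ ρ₀ := by linarith
  -- (i) the two UNTAGGED domain-local BLOCK expansions with DECAYING letters at their own rate ρ₀
  have hSw := blockWalkExpansion_domainLocalD hS hκ₁₀ hlamS hρ₀ hκ₀ hμ hwin hrow
  have hRw := blockWalkExpansion_domainLocalD hR hκ₁₀ hlamR hρ₀ hκ₀ hμ hwin hrow
  have hSdom : ∀ b, DomBy (toB6 (torusGeom K 0 0 0) 0 True) ((withOp L opS).dist ∅ b) := fun b => (withOp L opS).domBy_dist ∅ b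
  have hRdom : ∀ b, DomBy (toB6 (torusGeom K 0 0 0) 0 True) ((withOp L opR).dist ∅ b) := fun b => (withOp L opR).domBy_dist ∅ b
  -- GEN 4's glue with its witnesses kept
  have hone := blockWalkExpansion_one (d := d) (N' := N') (E := E) c₀ cubn (∅ : Finset (UT K)) R
    ((ρ₀ - μ) + μ - ((ρ₀ - 2 * μ) - (ε₀ - 2 * μ))) ((ρ₀ - 2 * μ) - (ε₀ - 2 * μ))
  have hinv := blockWalkExpansion_inv_pencil (A := fun (_ : TPt d N' → ℂ) (_ : E) => (1 : Matrix n n ℂ))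
    (t := (-1 : ℂ)) (τ := 1) (ρ := ρ₀ - 2 * μ) (ε := ε₀ - 2 * μ) (ρs := ρ₀ - μ) (κs := κ₀ - μ) (κ := κ₀ - 2 * μ)
    hone hRw (fun _ a b => le_rfl) hRdom (fun σ₀ _ u _ => Matrix.one_mul _) hrow hrow hμ hμ hcμ hcμ
    (by linarith) (by linarith) (by linarith) (by linarith) (by linarith) (by linarith) (by linarith) zero_le_one (by positivity)
    (by linarith) (by linarith) (by linarith) (by linarith) (by linarith) (by linarith) zero_le_one (by simp) hq
  have hq1 : 0 < 1 - cμ * (cμ * 1 * (1 * ((lamR * Real.exp (c₀.κ₁ * (0 : ℕ))) * Real.exp (μ * r) * (nD * cμ))) * cμ) * cμ := by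
    linarith
  have hCdom : ∀ ω : List (Unit × L.B) × Unit, DomBy (toB6 (torusGeom K 0 0 0) 0 True)
      (chainDist (g := toB6 (torusGeom K 0 0 0) 0 True)
        (fun i : Unit × L.B => infConv (g := toB6 (torusGeom K 0 0 0) 0 True) (tdist1 K)
          ((withOp L opR).dist ∅ i.2)) (tdist1 K) ω.1) :=
    fun ω => domBy_chain (DC := fun _ : Unit => tdist1 K) (fun _ a b => le_rfl) hRdom ω
  have hmul := blockWalkExpansion_mul (ρ := ρ₀ - 3 * μ) (ε := ε₀ - 3 * μ) (κ := κ₀ - 2 * μ) hSw hinv hSdom hCdom hrow hrow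
    (by linarith) (by linarith) hμ (by linarith) (by linarith) (by linarith) (by linarith) (by positivity) (by positivity)
    (by linarith) le_rfl (by linarith) hcμ
  -- (ii) route ONCE per walk: walks with a domain meeting X pass within 2r of X
  have hdom : ∀ b, (L.dom b).Nonempty := fun b => ⟨L.anchor b, hS.hanchor b⟩
  have hmulD : ∀ ω : L.B × (List (Unit × L.B) × Unit), DomBy (toB6 (torusGeom K 0 0 0) 0 True)
      (infConv (g := toB6 (torusGeom K 0 0 0) 0 True) ((withOp L opS).dist ∅ ω.1)
        (chainDist (g := toB6 (torusGeom K 0 0 0) 0 True)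
          (fun i : Unit × L.B => infConv (g := toB6 (torusGeom K 0 0 0) 0 True) (tdist1 K) ((withOp L opR).dist ∅ i.2))
          (tdist1 K) ω.2.1)) := fun ω => domBy_infConv_torus (hSdom ω.1) (hCdom ω.2)
  -- untagged families: NO term is σ-carrying (J = ∅ everywhere)
  have hJS : ∀ b, b ∉ (withOp L opS).sigmaCarrying := fun b hb => by
    have h1 : 0 < ((withOp L opS).J b).card := Finset.card_pos.2 hb
    have h2 := hS.hJ b
    omega
  have hJR : ∀ b, b ∉ (withOp L opR).sigmaCarrying := fun b hb => by
    have h1 : 0 < ((withOp L opR).J b).card := Finset.card_pos.2 hb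
    have h2 := hR.hJ b
    omega
  have hre := blockWalkExpansion_reroute hmul {ω | (L.dom ω.1 ∩ X).Nonempty ∨ ∃ i ∈ ω.2.1, (L.dom i.2 ∩ X).Nonempty} X
    (s := 2 * r) (by positivity)
    (fun ω _ σ hσ => hmul.indep ω (by
      rintro (h | h | ⟨i, _, h | h⟩)
      · exact hJS _ h
      · exact h
      · exact h
      · exact hJR _ h) σ hσ)
    (fun ω hω y y' => near_of_meets (X₀ := ∅) hdom hS.hdiam X ω.1 ω.2.1 hω y y')
  -- (iii) decorate ONCE per parameter under the tube letter
  refine ⟨_, _, _, _, decG J', blockWalkExpansion_decorate hre hκ₁₀ hκ₁ (decG J') (fun ω hω => ?_) (P₀ := P)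
    (P₁ := P / r₀) (fun ω u _ y y' _ => ?_) hshift, fun u hu => ?_, fun ω => domBy_reroute hmulD (by positivity) ω⟩
  · rcases decG_nonempty J' ω hω with h0 | ⟨i, hi, hJi⟩
    · exact Or.inl (hJ'X ω.1 h0)
    · exact Or.inr ⟨i, hi, hJ'X i.2 hJi⟩
  · have h := card_params_le (L := L) (X := ∅) hdom hr₀ hRD hS.hdiam cellOf hpack J' hJ' ω.1 ω.2.1 y y' (decG J' ω)
      (fun δ hδ => mem_decG J' ω.1 ω.2.1 ω.2.2 hδ)
    have e : (P : ℝ) * (1 + Dch L ∅ ω.1 ω.2.1 y y' / r₀) = P + P / r₀ * Dch L ∅ ω.1 ω.2.1 y y' := by ring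
    rw [e] at h
    have hP : 0 ≤ (P : ℝ) / r₀ := div_nonneg (Nat.cast_nonneg P) hr₀.le
    calc ((decG J' ω).card : ℝ) ≤ P + P / r₀ * Dch L ∅ ω.1 ω.2.1 y y' := h
      _ ≤ P + P / r₀ * (Dch L ∅ ω.1 ω.2.1 y y' + 2 * r) := by nlinarith
  · exact kernel_decorate_one hre hκ₁₀ (decG J') u hu

end End

end Summit.QuantumFields.BalabanUV.Gaps.D4WalkBlockOneScalePrint

end
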